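import Summits.AnomalousDissipation.AnomalousDissipation.Theorems.DenseLoudDesignerForces.Negative.PowerBudget

/-!
# Negative knowledge for the crux `DenseLoudDesignerForces` (stmt-AnomalousDissipation-1143), III: momentum budget

Certified copy of §5 of the cdisprove work file: pairing the momentum equation of a `τ`-periodic classical orbit
with a steady smooth solenoidal field `φ` and averaging over the period gives the EXACT mean balance
`τ∫⟪F,φ⟫ = -∫₀^τ∫⟪u,(u·∇)φ⟫ - ν∫₀^τ∫⟪u,Δφ⟫` (`momentum_period_identity`) and the bound
`|∫⟪F,φ⟫| ≤ ‖Dφ‖_∞⟨‖u‖²⟩ + (ν/2)(⟨‖u‖²⟩ + ∫‖Δφ‖²)` (`abs_integral_inner_force_le`): the force a bounded-energy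
periodic orbit can carry is bounded by its ENERGY, uniformly as `ν → 0`.  Supports stmt-AnomalousDissipation-1143.
-/

noncomputable section

namespace Summit.AnomalousDissipation.AnomalousDissipation.Theorems.DenseLoudDesignerForces.Negative

open scoped BigOperators Topology ENNReal InnerProductSpace
open Filter Set MeasureTheory UnitAddTorus
open Literature.Analysis.FunctionSpaces Literature.Analysis.FluidPDE
open Summit.AnomalousDissipation.AnomalousDissipation.Theses.BaireTransfer

/-! ## §5 The momentum budget of a periodic classical orbit (testing against steady solenoidal fields)

Pair the momentum equation with a steady smooth divergence-free field `φ` and average over a period: the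
time derivative integrates to zero, the pressure drops out, the Laplacian moves onto `φ`, and the
convective term is rewritten by antisymmetry of the trilinear form.  EXACT IDENTITY
`τ ∫⟪F,φ⟫ = -∫₀^τ∫⟪u,(u·∇)φ⟫ - ν∫₀^τ∫⟪u,Δφ⟫` and the bound
`|∫⟪F,φ⟫| ≤ ‖∇φ‖_∞ ⟨‖u‖²⟩ + (ν/2)(⟨‖u‖²⟩ + ∫‖Δφ‖²)`: the force a bounded-energy periodic orbit can
carry is bounded by its ENERGY, uniformly as `ν → 0`. -/

section MomentumBudget

variable {ν τ : ℝ} {F : (UnitAddTorus (Fin 3)) → (EuclideanSpace ℝ (Fin 3))} {u : ℝ → (UnitAddTorus (Fin 3)) → (EuclideanSpace ℝ (Fin 3))} {p : ℝ → (UnitAddTorus (Fin 3)) → ℝ} {φ : (UnitAddTorus (Fin 3)) → (EuclideanSpace ℝ (Fin 3))}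

/-- `d/dt ∫⟪u(t), φ⟫ = ∫⟪∂ₜu(t), φ⟫` for a jointly smooth `u` and a steady smooth `φ`. -/
theorem hasDerivAt_pairing (hu : Torus.IsSmoothSpaceTimeOn univ u) (hφ : Torus.IsSmooth φ) (t : ℝ) :
    HasDerivAt (fun s => ∫ x, ⟪u s x, φ x⟫_ℝ) (∫ x, ⟪Torus.timeDerivWithin univ u t x, φ x⟫_ℝ) t := by
  have hc : Torus.IsSmoothSpaceTimeOn univ (fun _ : ℝ => φ) := Torus.isSmoothSpaceTimeOn_const hφ univ
  have hG : Torus.IsSmoothSpaceTimeOn univ (fun s x => ⟪u s x, φ x⟫_ℝ) := hu.inner hc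
  have h1 := hG.hasDerivWithinAt_integral convex_univ (mem_univ t)
  have h2 : (fun x => Torus.timeDerivWithin univ (fun s y => ⟪u s y, φ y⟫_ℝ) t x) =
      fun x => ⟪Torus.timeDerivWithin univ u t x, φ x⟫_ℝ := by
    funext x
    rw [hu.timeDerivWithin_inner hc uniqueDiffOn_univ (mem_univ t) x]
    have : Torus.timeDerivWithin univ (fun (_ : ℝ) => φ) t x = 0 := by
      show derivWithin (fun _ : ℝ => φ x) univ t = 0
      rw [derivWithin_univ, deriv_const]
    rw [this, inner_zero_right, zero_add]
  rw [h2] at h1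
  exact h1.hasDerivAt univ_mem

/-- Over one period the pairing's derivative integrates to zero: `∫₀^τ ∫⟪∂ₜu, φ⟫ = 0`. -/
theorem period_integral_pairing_deriv (hu : Torus.IsSmoothSpaceTimeOn univ u) (hφ : Torus.IsSmooth φ)
    (hper : Function.Periodic u τ) :
    ∫ t in (0 : ℝ)..τ, ∫ x, ⟪Torus.timeDerivWithin univ u t x, φ x⟫_ℝ = 0 := by
  have hcont : Continuous fun t => ∫ x, ⟪Torus.timeDerivWithin univ u t x, φ x⟫_ℝ :=
    continuousOn_univ.1 (((hu.timeDerivWithin uniqueDiffOn_univ).inner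
      (Torus.isSmoothSpaceTimeOn_const hφ univ)).continuousOn_integral convex_univ)
  rw [intervalIntegral.integral_eq_sub_of_hasDerivAt (fun t _ => hasDerivAt_pairing hu hφ t)
    (hcont.intervalIntegrable _ _)]
  have h0 : u τ = u 0 := by simpa using hper 0
  simp [h0]

/-- The force of a global classical solution is smooth (it is `∂ₜu + (u·∇)u - νΔu + ∇p` at any time). -/
theorem isSmooth_of_solution (h : Torus.IsClassicalNSSolutionOn univ ν (fun _ => F) u p) :
    Torus.IsSmooth F := by
  have hu := h.smooth_velocity
  have hut : Torus.IsSmooth (u 0) := hu.isSmooth_slice (mem_univ 0)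
  have hpt : Torus.IsSmooth (p 0) := h.smooth_pressure.isSmooth_slice (mem_univ 0)
  have hsm : Torus.IsSmooth (fun x => Torus.timeDerivWithin univ u 0 x + Torus.convect (u 0) (u 0) x -
      ν • Torus.laplacian (u 0) x + Torus.gradient (p 0) x) :=
    ((((hu.timeDerivWithin uniqueDiffOn_univ).isSmooth_slice (mem_univ 0)).add
      (hut.convect hut)).sub (hut.laplacian.smul ν)).add hpt.gradient
  have hFeq : F = fun x => Torus.timeDerivWithin univ u 0 x + Torus.convect (u 0) (u 0) x -
      ν • Torus.laplacian (u 0) x + Torus.gradient (p 0) x := by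
    funext x
    have hm := h.momentum 0 (mem_univ 0) x
    calc F x = (ν • Torus.laplacian (u 0) x - Torus.gradient (p 0) x + F x) -
        ν • Torus.laplacian (u 0) x + Torus.gradient (p 0) x := by abel
      _ = _ := by rw [← hm]
  rw [hFeq]; exact hsm

/-- The paired momentum equation at a fixed time, for a steady smooth divergence-free test field `φ`:
`∫⟪∂ₜu, φ⟫ = ∫⟪u, (u·∇)φ⟫ + ν ∫⟪u, Δφ⟫ + ∫⟪F, φ⟫` (pressure-free; antisymmetry; Green). -/
theorem integral_inner_timeDeriv_eq (h : Torus.IsClassicalNSSolutionOn univ ν (fun _ => F) u p)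
    (hφ : Torus.IsSmooth φ) (hdiv : Torus.IsDivFree φ) (t : ℝ) :
    ∫ x, ⟪Torus.timeDerivWithin univ u t x, φ x⟫_ℝ =
      (∫ x, ⟪u t x, Torus.convect (u t) φ x⟫_ℝ) + ν * (∫ x, ⟪u t x, Torus.laplacian φ x⟫_ℝ) +
        ∫ x, ⟪F x, φ x⟫_ℝ := by
  have hu := h.smooth_velocity
  have hF : Torus.IsSmooth F := isSmooth_of_solution h
  have hut : Torus.IsSmooth (u t) := hu.isSmooth_slice (mem_univ t)
  have hpt : Torus.IsSmooth (p t) := h.smooth_pressure.isSmooth_slice (mem_univ t)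
  have hmom : ∀ x, Torus.timeDerivWithin univ u t x =
      ν • Torus.laplacian (u t) x - Torus.gradient (p t) x + F x - Torus.convect (u t) (u t) x := by
    intro x
    have := h.momentum t (mem_univ t) x
    rw [← this]; abel
  have hpoint : (fun x => ⟪Torus.timeDerivWithin univ u t x, φ x⟫_ℝ) = fun x =>
      ν * ⟪Torus.laplacian (u t) x, φ x⟫_ℝ - ⟪φ x, Torus.gradient (p t) x⟫_ℝ + ⟪F x, φ x⟫_ℝ -
        ⟪Torus.convect (u t) (u t) x, φ x⟫_ℝ := by
    funext x
    rw [hmom x, inner_sub_left, inner_add_left, inner_sub_left, real_inner_smul_left,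
      real_inner_comm (φ x) (Torus.gradient (p t) x)]
  rw [hpoint]
  have i1 : Integrable (fun x => ν * ⟪Torus.laplacian (u t) x, φ x⟫_ℝ) :=
    ((hut.laplacian.inner hφ).integrable).const_mul ν
  have i2 : Integrable (fun x => ⟪φ x, Torus.gradient (p t) x⟫_ℝ) := (hφ.inner hpt.gradient).integrable
  have i3 : Integrable (fun x => ⟪F x, φ x⟫_ℝ) := (hF.inner hφ).integrable
  have i4 : Integrable (fun x => ⟪Torus.convect (u t) (u t) x, φ x⟫_ℝ) :=
    ((hut.convect hut).inner hφ).integrable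
  have i12 : Integrable (fun x => ν * ⟪Torus.laplacian (u t) x, φ x⟫_ℝ - ⟪φ x, Torus.gradient (p t) x⟫_ℝ) :=
    i1.sub i2
  have i123 : Integrable (fun x => ν * ⟪Torus.laplacian (u t) x, φ x⟫_ℝ - ⟪φ x, Torus.gradient (p t) x⟫_ℝ +
      ⟪F x, φ x⟫_ℝ) := i12.add i3
  rw [integral_sub i123 i4, integral_add i12 i3, integral_sub i1 i2,
    integral_const_mul, Torus.integral_inner_laplacian_comm hut hφ,
    Torus.integral_inner_gradient_eq_neg_integral_mul_divergence_holds hφ hpt,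
    Torus.integral_inner_convect_eq_neg hut (h.divFree t (mem_univ t)) hut hφ]
  have hdiv0 : (fun x => p t x * Torus.divergence φ x) = fun _ => (0 : ℝ) :=
    funext fun x => by rw [hdiv x, mul_zero]
  rw [hdiv0, integral_zero]
  ring

/-- MOMENTUM PERIOD IDENTITY (exact mean balance over a period, "RANS against `φ`"):
`τ ∫⟪F, φ⟫ = -∫₀^τ ∫⟪u, (u·∇)φ⟫ - ν ∫₀^τ ∫⟪u, Δφ⟫` for every steady smooth solenoidal `φ`. -/
theorem momentum_period_identity (h : Torus.IsClassicalNSSolutionOn univ ν (fun _ => F) u p)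
    (hφ : Torus.IsSmooth φ) (hdiv : Torus.IsDivFree φ) (hper : Function.Periodic u τ) :
    τ * ∫ x, ⟪F x, φ x⟫_ℝ =
      -(∫ t in (0 : ℝ)..τ, ∫ x, ⟪u t x, Torus.convect (u t) φ x⟫_ℝ) -
        ν * ∫ t in (0 : ℝ)..τ, ∫ x, ⟪u t x, Torus.laplacian φ x⟫_ℝ := by
  have hu := h.smooth_velocity
  have hc : Torus.IsSmoothSpaceTimeOn univ (fun _ : ℝ => φ) := Torus.isSmoothSpaceTimeOn_const hφ univ
  have h0 := period_integral_pairing_deriv hu hφ hper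
  have hfun : (fun t => ∫ x, ⟪Torus.timeDerivWithin univ u t x, φ x⟫_ℝ) = fun t =>
      (∫ x, ⟪u t x, Torus.convect (u t) φ x⟫_ℝ) + ν * (∫ x, ⟪u t x, Torus.laplacian φ x⟫_ℝ) +
        ∫ x, ⟪F x, φ x⟫_ℝ := funext fun t => integral_inner_timeDeriv_eq h hφ hdiv t
  rw [hfun] at h0
  have hC1 : Continuous fun t => ∫ x, ⟪u t x, Torus.convect (u t) φ x⟫_ℝ :=
    continuousOn_univ.1 ((hu.inner (hu.convect hc uniqueDiffOn_univ)).continuousOn_integral convex_univ)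
  have hC2 : Continuous fun t => ∫ x, ⟪u t x, Torus.laplacian φ x⟫_ℝ :=
    continuousOn_univ.1 ((hu.inner (Torus.isSmoothSpaceTimeOn_const hφ.laplacian univ)).continuousOn_integral
      convex_univ)
  have hI1 : IntervalIntegrable (fun t => ∫ x, ⟪u t x, Torus.convect (u t) φ x⟫_ℝ) volume 0 τ :=
    hC1.intervalIntegrable _ _
  have hI2 : IntervalIntegrable (fun t => ν * ∫ x, ⟪u t x, Torus.laplacian φ x⟫_ℝ) volume 0 τ :=
    (hC2.intervalIntegrable _ _).const_mul ν
  have hI3 : IntervalIntegrable (fun _ : ℝ => ∫ x, ⟪F x, φ x⟫_ℝ) volume 0 τ := intervalIntegrable_const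
  rw [intervalIntegral.integral_add (hI1.add hI2) hI3, intervalIntegral.integral_add hI1 hI2,
    intervalIntegral.integral_const_mul, intervalIntegral.integral_const, sub_zero, smul_eq_mul] at h0
  linarith

/-- MOMENTUM BUDGET (abstract form).  If `‖Dφ(x)w‖ ≤ M‖w‖` for all `x, w` then every `τ`-periodic
classical orbit forced by the steady field `F` satisfies
`|∫⟪F, φ⟫| ≤ M·⟨‖u‖²⟩ + (ν/2)(⟨‖u‖²⟩ + ∫‖Δφ‖²)`. -/
theorem abs_integral_inner_force_le (h : Torus.IsClassicalNSSolutionOn univ ν (fun _ => F) u p)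
    (hν : 0 ≤ ν) (hφ : Torus.IsSmooth φ) (hdiv : Torus.IsDivFree φ) {M : ℝ}
    (hM : ∀ x w, ‖Torus.fderiv φ x w‖ ≤ M * ‖w‖) (hper : Function.Periodic u τ) (hτ : 0 < τ) :
    |∫ x, ⟪F x, φ x⟫_ℝ| ≤
      M * meanEnergy u + ν / 2 * (meanEnergy u + ∫ x, ‖Torus.laplacian φ x‖ ^ 2) := by
  have hu := h.smooth_velocity
  have hc : Torus.IsSmoothSpaceTimeOn univ (fun _ : ℝ => φ) := Torus.isSmoothSpaceTimeOn_const hφ univ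
  have hid := momentum_period_identity h hφ hdiv hper
  -- the energy profile
  have he_st : Torus.IsSmoothSpaceTimeOn univ (fun t x => ‖u t x‖ ^ 2) := by
    change ContDiffOn ℝ _ (fun z => ‖Torus.stLift u z‖ ^ 2) _
    exact hu.norm_sq ℝ
  have he_cont : Continuous fun t => ∫ x, ‖u t x‖ ^ 2 :=
    continuousOn_univ.1 (he_st.continuousOn_integral convex_univ)
  set e : ℝ → ℝ := fun t => ∫ x, ‖u t x‖ ^ 2 with he_def
  set L : ℝ := ∫ x, ‖Torus.laplacian φ x‖ ^ 2 with hL_def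
  have hL : 0 ≤ L := integral_nonneg fun _ => sq_nonneg _
  -- bound on the convective pairing, slice-wise then in time
  have hconv_pt : ∀ t, |∫ x, ⟪u t x, Torus.convect (u t) φ x⟫_ℝ| ≤ M * e t := by
    intro t
    have hut : Torus.IsSmooth (u t) := hu.isSmooth_slice (mem_univ t)
    have hb := norm_integral_le_of_norm_le (hut.norm_sq.integrable.const_mul M)
      (ae_of_all _ fun x => show ‖⟪u t x, Torus.convect (u t) φ x⟫_ℝ‖ ≤ M * ‖u t x‖ ^ 2 from by
        rw [Real.norm_eq_abs]
        calc |⟪u t x, Torus.convect (u t) φ x⟫_ℝ| ≤ ‖u t x‖ * ‖Torus.convect (u t) φ x‖ :=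
              abs_real_inner_le_norm _ _
          _ ≤ ‖u t x‖ * (M * ‖u t x‖) := by
              gcongr
              exact hM x (u t x)
          _ = M * ‖u t x‖ ^ 2 := by ring)
    rw [Real.norm_eq_abs, integral_const_mul] at hb
    exact hb
  have hlap_pt : ∀ t, |∫ x, ⟪u t x, Torus.laplacian φ x⟫_ℝ| ≤ (e t + L) / 2 := by
    intro t
    have hut : Torus.IsSmooth (u t) := hu.isSmooth_slice (mem_univ t)
    have hint : Integrable (fun x => (‖u t x‖ ^ 2 + ‖Torus.laplacian φ x‖ ^ 2) / 2) :=
      (hut.norm_sq.integrable.add hφ.laplacian.norm_sq.integrable).div_const 2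
    have hb := norm_integral_le_of_norm_le hint (ae_of_all _ fun x =>
      show ‖⟪u t x, Torus.laplacian φ x⟫_ℝ‖ ≤ (‖u t x‖ ^ 2 + ‖Torus.laplacian φ x‖ ^ 2) / 2 from by
        rw [Real.norm_eq_abs]
        calc |⟪u t x, Torus.laplacian φ x⟫_ℝ| ≤ ‖u t x‖ * ‖Torus.laplacian φ x‖ := abs_real_inner_le_norm _ _
          _ ≤ (‖u t x‖ ^ 2 + ‖Torus.laplacian φ x‖ ^ 2) / 2 := by
              nlinarith [sq_nonneg (‖u t x‖ - ‖Torus.laplacian φ x‖)])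
    rw [Real.norm_eq_abs, integral_div, integral_add hut.norm_sq.integrable hφ.laplacian.norm_sq.integrable] at hb
    exact hb
  have hconv_time : |∫ t in (0 : ℝ)..τ, ∫ x, ⟪u t x, Torus.convect (u t) φ x⟫_ℝ| ≤
      M * ∫ t in (0 : ℝ)..τ, e t := by
    have := intervalIntegral.norm_integral_le_of_norm_le hτ.le
      (ae_of_all _ fun t _ => (Real.norm_eq_abs _).trans_le (hconv_pt t))
      ((he_cont.intervalIntegrable (μ := volume) 0 τ).const_mul M)
    rw [Real.norm_eq_abs, intervalIntegral.integral_const_mul] at this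
    exact this
  have hlap_time : |∫ t in (0 : ℝ)..τ, ∫ x, ⟪u t x, Torus.laplacian φ x⟫_ℝ| ≤
      ((∫ t in (0 : ℝ)..τ, e t) + τ * L) / 2 := by
    have := intervalIntegral.norm_integral_le_of_norm_le hτ.le
      (ae_of_all _ fun t _ => (Real.norm_eq_abs _).trans_le (hlap_pt t))
      (((he_cont.add continuous_const).div_const 2).intervalIntegrable (μ := volume) 0 τ)
    rw [Real.norm_eq_abs] at this
    refine this.trans_eq ?_
    rw [intervalIntegral.integral_div, intervalIntegral.integral_add (he_cont.intervalIntegrable _ _)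
      intervalIntegrable_const, intervalIntegral.integral_const, sub_zero, smul_eq_mul]
  -- assemble
  have hE : meanEnergy u = τ⁻¹ * ∫ t in (0 : ℝ)..τ, e t := meanEnergy_eq_period_mean hper hτ
  have hIe : 0 ≤ ∫ t in (0 : ℝ)..τ, e t :=
    intervalIntegral.integral_nonneg hτ.le fun t _ => integral_nonneg fun _ => sq_nonneg _
  have key : τ * |∫ x, ⟪F x, φ x⟫_ℝ| ≤ M * (∫ t in (0 : ℝ)..τ, e t) +
      ν * (((∫ t in (0 : ℝ)..τ, e t) + τ * L) / 2) := by
    have habs : |τ * ∫ x, ⟪F x, φ x⟫_ℝ| = τ * |∫ x, ⟪F x, φ x⟫_ℝ| := by rw [abs_mul, abs_of_pos hτ]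
    rw [← habs, hid]
    calc |-(∫ t in (0 : ℝ)..τ, ∫ x, ⟪u t x, Torus.convect (u t) φ x⟫_ℝ) -
          ν * ∫ t in (0 : ℝ)..τ, ∫ x, ⟪u t x, Torus.laplacian φ x⟫_ℝ|
        ≤ |(∫ t in (0 : ℝ)..τ, ∫ x, ⟪u t x, Torus.convect (u t) φ x⟫_ℝ)| +
          |ν * ∫ t in (0 : ℝ)..τ, ∫ x, ⟪u t x, Torus.laplacian φ x⟫_ℝ| := by
            rw [sub_eq_add_neg]; exact (abs_add_le _ _).trans (by rw [abs_neg, abs_neg])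
      _ ≤ M * (∫ t in (0 : ℝ)..τ, e t) + ν * (((∫ t in (0 : ℝ)..τ, e t) + τ * L) / 2) := by
            rw [abs_mul, abs_of_nonneg hν]
            gcongr
  rw [hE]
  have hτinv : 0 < τ⁻¹ := inv_pos.2 hτ
  have := mul_le_mul_of_nonneg_left key hτinv.le
  rw [← mul_assoc, inv_mul_cancel₀ hτ.ne', one_mul] at this
  refine this.trans_eq ?_
  have hI : τ⁻¹ * (τ * L) = L := by rw [← mul_assoc, inv_mul_cancel₀ hτ.ne', one_mul]
  calc τ⁻¹ * (M * (∫ t in (0 : ℝ)..τ, e t) + ν * (((∫ t in (0 : ℝ)..τ, e t) + τ * L) / 2))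
      = M * (τ⁻¹ * ∫ t in (0 : ℝ)..τ, e t) + ν / 2 * (τ⁻¹ * (∫ t in (0 : ℝ)..τ, e t) + τ⁻¹ * (τ * L)) := by
        ring
    _ = M * (τ⁻¹ * ∫ t in (0 : ℝ)..τ, e t) + ν / 2 * (τ⁻¹ * (∫ t in (0 : ℝ)..τ, e t) + L) := by rw [hI]

end MomentumBudget

end Summit.AnomalousDissipation.AnomalousDissipation.Theorems.DenseLoudDesignerForces.Negative

end
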